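import Summits.AtomisticToContinuum.BoseEinsteinCondensation.Theses.BECStronglyRayleigh
import Summits.AtomisticToContinuum.BoseEinsteinCondensation.Theorems.BECStronglyRayleighGroundStateStabilityConeSelection
import Literature.Combinatorics.StablePolynomials.KernelForm
import Literature.MathematicalPhysics.QuantumLattice.LiebMattisMatrixElements
import HarnessLib

/-!
# Stub `stub_eulerGate` (line `stable-cone-variational-selection`, crux `GroundStateStability`,
# stmt-AtomisticToContinuum-9672): the Euler bond gate is a Borcea–Brändén preserver

For `x ≠ y`, `|Δ| ≤ 1`, `0 ≤ ε ≤ 1` the gate `1 + ε(S¹_xS¹_y + S²_xS²_y + ΔS³_xS³_y)` maps a vector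
whose occupation polynomial `Σ_S φ(1_S) z^S` has no zero in `H^Λ` to `0` or to such a vector.
Proof: the bond acts in the occupation basis by `(Bφ)(σ) = Δ(±¼)φ(σ) + ½[σ_x ≠ σ_y]φ(σ^{xy})`
(`gate_xxzBond_mulVec_apply`), so the gate acts on `S ↦ φ(1_S)` through a two-delta kernel whose
Borcea–Brändén symbol factorises as `q(z_x,z_y,w_x,w_y)·∏_{i≠x,y}(z_i+w_i)` (`gate_symbol_eq`) with
the six-vertex quadratic `q = a(z_xz_y+w_xw_y) + b(z_xw_y+z_yw_x) + c(z_xw_x+z_yw_y)`,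
`(a,b,c) = (1+εΔ/4, 1-εΔ/4, ε/2)`; `q ≠ 0` on `H⁴` in the triangle window (`gate_quad_ne_zero`:
Klein-four diagonalisation `8q = (a+b+c)L₀² - (a+b-c)L₁² - (b+c-a)L₂² - (a+c-b)L₃²` plus weighted
Cauchy–Schwarz on the real 2-plane `Re v, Im v`); conclude with the proved kernel form of
Borcea–Brändén's Lemma 2.2 (`multiAffine_kernel_stable_or_zero`).
-/

noncomputable section

namespace Summit.AtomisticToContinuum.BoseEinsteinCondensation.Cruxes.GroundStateStability.StableConeVariationalSelection

open scoped BigOperators Matrix ComplexOrder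
open Literature.MathematicalPhysics.QuantumLattice
open Literature.Combinatorics.StablePolynomials
open Matrix Finset Complex

/-! ### The Lorentzian six-vertex quadratic has no zeros in `H⁴` -/

/-- Weighted Cauchy–Schwarz in the real 2-plane: if `Σ αⱼxⱼ² < s x₀²`, `Σ αⱼyⱼ² < s y₀²` with
nonnegative weights, then `s x₀y₀ ≠ Σ αⱼ xⱼ yⱼ`. [folklore] -/
theorem gate_lorentz_real {s α β γ : ℝ} (hα : 0 ≤ α) (hβ : 0 ≤ β) (hγ : 0 ≤ γ)
    {x₀ x₁ x₂ x₃ y₀ y₁ y₂ y₃ : ℝ}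
    (hx : α * x₁ ^ 2 + β * x₂ ^ 2 + γ * x₃ ^ 2 < s * x₀ ^ 2)
    (hy : α * y₁ ^ 2 + β * y₂ ^ 2 + γ * y₃ ^ 2 < s * y₀ ^ 2)
    (hB : s * x₀ * y₀ = α * x₁ * y₁ + β * x₂ * y₂ + γ * x₃ * y₃) : False := by
  have hX : 0 ≤ α * x₁ ^ 2 + β * x₂ ^ 2 + γ * x₃ ^ 2 := by positivity
  have hCS : (α * x₁ * y₁ + β * x₂ * y₂ + γ * x₃ * y₃) ^ 2 ≤
      (α * x₁ ^ 2 + β * x₂ ^ 2 + γ * x₃ ^ 2) * (α * y₁ ^ 2 + β * y₂ ^ 2 + γ * y₃ ^ 2) := by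
    nlinarith [mul_nonneg (mul_nonneg hα hβ) (sq_nonneg (x₁ * y₂ - x₂ * y₁)),
      mul_nonneg (mul_nonneg hα hγ) (sq_nonneg (x₁ * y₃ - x₃ * y₁)),
      mul_nonneg (mul_nonneg hβ hγ) (sq_nonneg (x₂ * y₃ - x₃ * y₂))]
  have hlt : (α * x₁ ^ 2 + β * x₂ ^ 2 + γ * x₃ ^ 2) * (α * y₁ ^ 2 + β * y₂ ^ 2 + γ * y₃ ^ 2) <
      (s * x₀ ^ 2) * (s * y₀ ^ 2) := mul_lt_mul'' hx hy hX (by positivity)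
  have : (s * x₀ * y₀) ^ 2 < (s * x₀ * y₀) ^ 2 := by
    calc (s * x₀ * y₀) ^ 2 = (α * x₁ * y₁ + β * x₂ * y₂ + γ * x₃ * y₃) ^ 2 := by rw [hB]
      _ < (s * x₀ ^ 2) * (s * y₀ ^ 2) := hCS.trans_lt hlt
      _ = (s * x₀ * y₀) ^ 2 := by ring
  exact lt_irrefl _ this

/-- **The six-vertex quadratic is upper-half-plane stable in the triangle window.** For
`a, b, c ≥ 0`, not all zero, satisfying the triangle inequalities, the multi-affine quadratic
`q = a(z₁z₂ + w₁w₂) + b(z₁w₂ + z₂w₁) + c(z₁w₁ + z₂w₂)` has no zero with all four variables in the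
open upper half-plane (its Hessian, a Klein-four group matrix, has exactly one positive
eigenvalue: `8q = (a+b+c)L₀² - (a+b-c)L₁² - (b+c-a)L₂² - (a+c-b)L₃²`). [folklore] -/
theorem gate_quad_ne_zero {a b c : ℝ} (ha : 0 ≤ a) (hb : 0 ≤ b) (hc : 0 ≤ c)
    (h₁ : a ≤ b + c) (h₂ : b ≤ a + c) (h₃ : c ≤ a + b) (hs : 0 < a + b + c)
    {z₁ z₂ w₁ w₂ : ℂ} (hz₁ : 0 < z₁.im) (hz₂ : 0 < z₂.im) (hw₁ : 0 < w₁.im) (hw₂ : 0 < w₂.im) :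
    (a : ℂ) * (z₁ * z₂ + w₁ * w₂) + b * (z₁ * w₂ + z₂ * w₁) + c * (z₁ * w₁ + z₂ * w₂) ≠ 0 := by
  intro hq
  -- real coordinates
  set p₁ := z₁.re; set p₂ := z₂.re; set p₃ := w₁.re; set p₄ := w₂.re
  set r₁ := z₁.im; set r₂ := z₂.im; set r₃ := w₁.im; set r₄ := w₂.im
  have ez₁ : z₁ = p₁ + r₁ * I := (re_add_im z₁).symm
  have ez₂ : z₂ = p₂ + r₂ * I := (re_add_im z₂).symm
  have ew₁ : w₁ = p₃ + r₃ * I := (re_add_im w₁).symm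
  have ew₂ : w₂ = p₄ + r₄ * I := (re_add_im w₂).symm
  rw [ez₁, ez₂, ew₁, ew₂] at hq
  have hre := congrArg Complex.re hq
  have him := congrArg Complex.im hq
  simp only [add_re, mul_re, ofReal_re, ofReal_im, I_re, I_im, add_im, mul_im, zero_re,
    zero_im, mul_zero, mul_one, zero_mul, sub_zero, add_zero, zero_add] at hre him
  -- the character coordinates
  set X₀ := p₁ + p₂ + p₃ + p₄; set X₁ := p₁ - p₂ + p₃ - p₄
  set X₂ := p₁ + p₂ - p₃ - p₄; set X₃ := p₁ - p₂ - p₃ + p₄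
  set Y₀ := r₁ + r₂ + r₃ + r₄; set Y₁ := r₁ - r₂ + r₃ - r₄
  set Y₂ := r₁ + r₂ - r₃ - r₄; set Y₃ := r₁ - r₂ - r₃ + r₄
  set s := a + b + c; set α := a + b - c; set β := b + c - a; set γ := a + c - b
  have hα : 0 ≤ α := by simp only [α]; linarith
  have hβγ : 0 ≤ β ∧ 0 ≤ γ := ⟨by simp only [β]; linarith, by simp only [γ]; linarith⟩
  -- positivity of `q` at the (positive) imaginary parts
  have hqr : 0 < a * (r₁ * r₂ + r₃ * r₄) + b * (r₁ * r₄ + r₂ * r₃) + c * (r₁ * r₃ + r₂ * r₄) := by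
    have h12 : 0 < r₁ * r₂ + r₃ * r₄ := by positivity
    have h14 : 0 < r₁ * r₄ + r₂ * r₃ := by positivity
    have h13 : 0 < r₁ * r₃ + r₂ * r₄ := by positivity
    by_contra hle
    push Not at hle
    have ha0 : a = 0 := by nlinarith [mul_nonneg hb h14.le, mul_nonneg hc h13.le, mul_nonneg ha h12.le]
    have hb0 : b = 0 := by nlinarith [mul_nonneg ha h12.le, mul_nonneg hc h13.le, mul_nonneg hb h14.le]
    have hc0 : c = 0 := by nlinarith [mul_nonneg ha h12.le, mul_nonneg hb h14.le, mul_nonneg hc h13.le]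
    simp only [s, ha0, hb0, hc0, add_zero] at hs
    exact lt_irrefl _ hs
  -- the diagonalised forms
  have hY : s * Y₀ ^ 2 - (α * Y₁ ^ 2 + β * Y₂ ^ 2 + γ * Y₃ ^ 2) =
      8 * (a * (r₁ * r₂ + r₃ * r₄) + b * (r₁ * r₄ + r₂ * r₃) + c * (r₁ * r₃ + r₂ * r₄)) := by
    simp only [s, α, β, γ, Y₀, Y₁, Y₂, Y₃]; ring
  have hXY : s * X₀ ^ 2 - (α * X₁ ^ 2 + β * X₂ ^ 2 + γ * X₃ ^ 2) =
      s * Y₀ ^ 2 - (α * Y₁ ^ 2 + β * Y₂ ^ 2 + γ * Y₃ ^ 2) := by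
    simp only [s, α, β, γ, X₀, X₁, X₂, X₃, Y₀, Y₁, Y₂, Y₃]
    linear_combination (8 : ℝ) * hre
  have hBr : s * X₀ * Y₀ = α * X₁ * Y₁ + β * X₂ * Y₂ + γ * X₃ * Y₃ := by
    simp only [s, α, β, γ, X₀, X₁, X₂, X₃, Y₀, Y₁, Y₂, Y₃]
    linear_combination (4 : ℝ) * him
  exact gate_lorentz_real hα hβγ.1 hβγ.2 (x₀ := X₀) (y₀ := Y₀) (by linarith) (by linarith) hBr

/-! ### Action of the XXZ bond in the occupation basis -/

section Action

variable {Λ : Type*} [Fintype Λ] [DecidableEq Λ]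

/-- Two single-site operators at distinct sites act on two coordinates. [folklore] -/
theorem gate_onSite_mul_onSite_mulVec_apply {q : ℕ} {x y : Λ} (hxy : x ≠ y)
    (a b : Matrix (Fin q) (Fin q) ℂ) (φ : TensorIndex Λ q → ℂ) (σ : TensorIndex Λ q) :
    ((onSite x a * onSite y b : Op Λ q) *ᵥ φ) σ =
      ∑ l, ∑ m, a (σ x) l * b (σ y) m * φ (Function.update (Function.update σ x l) y m) := by
  -- adapted from Cruxes/GroundStateStability/Disproof.lean (cdisprove seat), `onSite_mul_onSite_mulVec_apply`
  rw [← Matrix.mulVec_mulVec, LiebMattis.onSite_mulVec_apply]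
  refine Finset.sum_congr rfl fun l _ => ?_
  rw [LiebMattis.onSite_mulVec_apply, Function.update_of_ne hxy.symm, Finset.mul_sum]
  refine Finset.sum_congr rfl fun m _ => ?_
  ring

/-- **Action of the spin-½ XXZ bond in the occupation basis**:
`(SˣSˣ+SʸSʸ+ΔSᶻSᶻ)_{xy} φ (σ) = Δ s_x s_y φ(σ) + ½[σ_x ≠ σ_y] φ(σ with x,y swapped)`,
`s = ±½`. [folklore] -/
theorem gate_xxzBond_mulVec_apply {x y : Λ} (hxy : x ≠ y) (Δ : ℂ) (φ : TensorIndex Λ 2 → ℂ)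
    (σ : TensorIndex Λ 2) :
    ((spinBond 1 0 x y + spinBond 1 1 x y + Δ • spinBond 1 2 x y) *ᵥ φ) σ =
      Δ * (if σ x = σ y then (1 / 4 : ℂ) else -(1 / 4 : ℂ)) * φ σ +
        (if σ x = σ y then 0 else
          (1 / 2 : ℂ) * φ (Function.update (Function.update σ x (σ y)) y (σ x))) := by
  -- adapted from Cruxes/GroundStateStability/Disproof.lean (cdisprove seat), `xxzBond_mulVec_apply`
  have key : ∀ i : Fin 2, i = 0 ∨ i = 1 := by decide
  have hcomm : ∀ (l m : Fin 2), Function.update (Function.update σ y m) x l =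
      Function.update (Function.update σ x l) y m := fun l m => Function.update_comm hxy.symm _ _ _
  simp only [spinBond, siteSpin, spinVec_one_eq_half_spinHalfPauli, Matrix.add_mulVec,
    Matrix.smul_mulVec, Pi.add_apply, Pi.smul_apply, smul_eq_mul,
    gate_onSite_mul_onSite_mulVec_apply hxy, gate_onSite_mul_onSite_mulVec_apply hxy.symm, hcomm,
    Matrix.smul_apply]
  have h1 : Function.update (Function.update σ x (σ x)) y (σ y) = σ := by
    simp only [Function.update_eq_self]
  rcases key (σ x) with hx | hx <;> rcases key (σ y) with hy | hy <;> rw [hx, hy] at h1 <;>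
    simp [hx, hy, spinHalfPauli, h1] <;> ring_nf <;> simp [Complex.I_sq] <;> ring

/-! ### Occupation indicators: the bond gate as a kernel on `Finset Λ` -/

omit [Fintype Λ] in
/-- For the indicator configuration `1_S`, `(1_S) x = (1_S) y ↔ (x ∈ S ↔ y ∈ S)`. [folklore] -/
theorem gate_ind_apply_eq_iff (S : Finset Λ) (x y : Λ) :
    ((if x ∈ S then (0 : Fin 2) else 1) = if y ∈ S then (0 : Fin 2) else 1) ↔ (x ∈ S ↔ y ∈ S) := by
  by_cases hx : x ∈ S <;> by_cases hy : y ∈ S <;> simp [hx, hy]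

omit [Fintype Λ] in
/-- Swapping the values of `1_S` at `x, y` gives the indicator of the image of `S` under the
transposition `(x y)`. [folklore] -/
theorem gate_swap_ind {x y : Λ} (hxy : x ≠ y) (S : Finset Λ) :
    Function.update (Function.update (fun i => if i ∈ S then (0 : Fin 2) else 1) x
        ((fun i => if i ∈ S then (0 : Fin 2) else 1) y))
        y ((fun i => if i ∈ S then (0 : Fin 2) else 1) x) =
      fun i => if i ∈ S.map (Equiv.swap x y).toEmbedding then (0 : Fin 2) else 1 := by
  funext i
  simp only [Finset.mem_map_equiv, Equiv.symm_swap]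
  by_cases hiy : i = y
  · subst hiy
    rw [Function.update_self, Equiv.swap_apply_right]
  · rw [Function.update_of_ne hiy]
    by_cases hix : i = x
    · subst hix
      rw [Function.update_self, Equiv.swap_apply_left]
    · rw [Function.update_of_ne hix, Equiv.swap_apply_of_ne_of_ne hix hiy]

/-- **The gate acts on the coefficients `S ↦ φ(1_S)` through the two-delta kernel**
`K(S', S) = [S = S'](1 + εΔ q_{S'}) + [S = (x y)·S'] ε h_{S'}`. [folklore] -/
theorem gate_action {x y : Λ} (hxy : x ≠ y) (Δ ε : ℂ) (φ : TensorIndex Λ 2 → ℂ) (S' : Finset Λ) :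
    ((1 + ε • (spinBond 1 0 x y + spinBond 1 1 x y + Δ • spinBond 1 2 x y)) *ᵥ φ)
        (fun i => if i ∈ S' then 0 else 1) =
      ∑ S : Finset Λ,
        ((if S = S' then 1 + ε * Δ * (if (x ∈ S' ↔ y ∈ S') then (1 / 4 : ℂ) else -(1 / 4 : ℂ)) else 0) +
          (if S = S'.map (Equiv.swap x y).toEmbedding then
            ε * (if (x ∈ S' ↔ y ∈ S') then (0 : ℂ) else (1 / 2 : ℂ)) else 0)) *
        φ (fun i => if i ∈ S then 0 else 1) := by
  simp only [add_mul, ite_mul, zero_mul, Finset.sum_add_distrib, Finset.sum_ite_eq',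
    Finset.mem_univ, if_true]
  rw [Matrix.add_mulVec, Matrix.one_mulVec, Matrix.smul_mulVec, Pi.add_apply, Pi.smul_apply,
    smul_eq_mul, gate_xxzBond_mulVec_apply hxy, gate_swap_ind hxy]
  have hiff := gate_ind_apply_eq_iff S' x y
  simp only [hiff]
  by_cases hc : (x ∈ S' ↔ y ∈ S')
  · simp only [hc, if_true]; ring
  · simp only [hc, if_false]; ring

/-! ### The Borcea–Brändén symbol of the gate factorises -/

/-- Summing the two-delta kernel against any function of `S`. [folklore] -/
theorem gate_inner_sum (S' T : Finset Λ) (A B : ℂ) (F : Finset Λ → ℂ) :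
    ∑ S : Finset Λ, ((if S = S' then A else 0) + (if S = T then B else 0)) * F S = A * F S' + B * F T := by
  simp only [add_mul, ite_mul, zero_mul, Finset.sum_add_distrib, Finset.sum_ite_eq',
    Finset.mem_univ, if_true]

/-- A sum over all subsets, split according to the membership of two distinguished sites `x, y`
(`univ = insert x (insert y R)`). [folklore] -/
theorem gate_sum_pair {x y : Λ} {R : Finset Λ} (hR : insert x (insert y R) = univ) (hxR : x ∉ R)
    (hyR : y ∉ R) (hxy : x ≠ y) (F : Finset Λ → ℂ) :
    ∑ S : Finset Λ, F S =
      ∑ T ∈ R.powerset, (F T + F (insert y T) + (F (insert x T) + F (insert x (insert y T)))) := by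
  have hx' : x ∉ insert y R := by simp [hxR, hxy]
  calc ∑ S : Finset Λ, F S = ∑ S ∈ (insert x (insert y R)).powerset, F S := by
        rw [hR, Finset.powerset_univ]
    _ = ∑ T ∈ R.powerset, (F T + F (insert y T) + (F (insert x T) + F (insert x (insert y T)))) := by
        rw [Finset.sum_powerset_insert hx', Finset.sum_powerset_insert hyR,
          Finset.sum_powerset_insert hyR, ← Finset.sum_add_distrib, ← Finset.sum_add_distrib,
          ← Finset.sum_add_distrib]

/-- Complements of the four subsets over a fixed `T ⊆ R = univ ∖ {x, y}`. [folklore] -/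
theorem gate_compl_eq {x y : Λ} {R T : Finset Λ} (hR : insert x (insert y R) = univ) (hxR : x ∉ R)
    (hyR : y ∉ R) (hxy : x ≠ y) (hT : T ⊆ R) :
    Tᶜ = insert x (insert y (R \ T)) ∧ (insert x T)ᶜ = insert y (R \ T) ∧
      (insert y T)ᶜ = insert x (R \ T) ∧ (insert x (insert y T))ᶜ = R \ T := by
  have hmem : ∀ i, i = x ∨ i = y ∨ i ∈ R := fun i => by
    have h : i ∈ insert x (insert y R) := hR ▸ Finset.mem_univ i
    simpa only [Finset.mem_insert] using h
  have h1 : ∀ i, i = x → i ∉ T ∧ i ∉ R ∧ i ≠ y := by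
    rintro i rfl
    exact ⟨fun h => hxR (hT h), hxR, hxy⟩
  have h2 : ∀ i, i = y → i ∉ T ∧ i ∉ R ∧ i ≠ x := by
    rintro i rfl
    exact ⟨fun h => hyR (hT h), hyR, hxy.symm⟩
  have h3 : ∀ i, i ∈ T → i ∈ R := fun i h => hT h
  refine ⟨?_, ?_, ?_, ?_⟩ <;> ext i <;>
    simp only [Finset.mem_compl, Finset.mem_insert, Finset.mem_sdiff] <;>
    specialize hmem i <;> specialize h1 i <;> specialize h2 i <;> specialize h3 i <;> tauto

omit [Fintype Λ] in
/-- The transposition `(x y)` maps `insert x T` to `insert y T` and vice versa (`x, y ∉ T`).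
[folklore] -/
theorem gate_map_swap_insert {x y : Λ} {T : Finset Λ} (hxT : x ∉ T) (hyT : y ∉ T) :
    (insert x T).map (Equiv.swap x y).toEmbedding = insert y T ∧
      (insert y T).map (Equiv.swap x y).toEmbedding = insert x T := by
  constructor <;> ext i <;> simp only [Finset.mem_map_equiv, Equiv.symm_swap, Finset.mem_insert] <;>
    by_cases hix : i = x <;> by_cases hiy : i = y
  all_goals first
    | (subst hix; subst hiy; simp)
    | (subst hix; simp [Equiv.swap_apply_left, hxT, hyT, hiy, Ne.symm hiy])
    | (subst hiy; simp [Equiv.swap_apply_right, hxT, hyT, hix, Ne.symm hix])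
    | simp [Equiv.swap_apply_of_ne_of_ne hix hiy, hix, hiy]

/-- Exchanging the two sums of the symbol and contracting the deltas:
`Σ_S (Σ_{S'} K(S',S) z^{S'}) w^{Sᶜ} = Σ_{S'} z^{S'} (A_{S'} w^{S'ᶜ} + B_{S'} w^{(sw S')ᶜ})`. [folklore] -/
theorem gate_symbol_rearrange (A B : Finset Λ → ℂ) (sw : Finset Λ → Finset Λ) (z w : Λ → ℂ) :
    (∑ S : Finset Λ, (∑ S' : Finset Λ,
        ((if S = S' then A S' else 0) + (if S = sw S' then B S' else 0)) * ∏ i ∈ S', z i) *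
          ∏ i ∈ Sᶜ, w i) =
      ∑ S' : Finset Λ, (∏ i ∈ S', z i) * (A S' * ∏ i ∈ S'ᶜ, w i + B S' * ∏ i ∈ (sw S')ᶜ, w i) := by
  calc (∑ S : Finset Λ, (∑ S' : Finset Λ,
        ((if S = S' then A S' else 0) + (if S = sw S' then B S' else 0)) * ∏ i ∈ S', z i) *
          ∏ i ∈ Sᶜ, w i)
      = ∑ S : Finset Λ, ∑ S' : Finset Λ,
          ((if S = S' then A S' else 0) + (if S = sw S' then B S' else 0)) * (∏ i ∈ S', z i) *
            ∏ i ∈ Sᶜ, w i := by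
        refine Finset.sum_congr rfl fun S _ => ?_
        rw [Finset.sum_mul]
    _ = ∑ S' : Finset Λ, ∑ S : Finset Λ,
          ((if S = S' then A S' else 0) + (if S = sw S' then B S' else 0)) * (∏ i ∈ S', z i) *
            ∏ i ∈ Sᶜ, w i := Finset.sum_comm
    _ = ∑ S' : Finset Λ, (∏ i ∈ S', z i) * (A S' * ∏ i ∈ S'ᶜ, w i + B S' * ∏ i ∈ (sw S')ᶜ, w i) := by
        refine Finset.sum_congr rfl fun S' _ => ?_
        rw [← gate_inner_sum S' (sw S') (A S') (B S') (fun S => ∏ i ∈ Sᶜ, w i), Finset.mul_sum]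
        refine Finset.sum_congr rfl fun S _ => ?_
        ring

/-- **The four subsets over a fixed `T ⊆ R = univ ∖ {x, y}` contribute `z^T w^{R∖T} · q`**, with
the six-vertex quadratic `q = a(z_xz_y + w_xw_y) + b(z_xw_y + z_yw_x) + c(z_xw_x + z_yw_y)`,
`a = 1 + εΔ/4`, `b = 1 - εΔ/4`, `c = ε/2`. [folklore] -/
theorem gate_four_terms {x y : Λ} {R T : Finset Λ} (hR : insert x (insert y R) = univ) (hxR : x ∉ R)
    (hyR : y ∉ R) (hxy : x ≠ y) (hT : T ⊆ R) (Δ ε : ℂ) (z w : Λ → ℂ) (F : Finset Λ → ℂ)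
    (hF : ∀ S' : Finset Λ, F S' = (∏ i ∈ S', z i) *
      ((1 + ε * Δ * (if (x ∈ S' ↔ y ∈ S') then (1 / 4 : ℂ) else -(1 / 4 : ℂ))) * ∏ i ∈ S'ᶜ, w i +
        ε * (if (x ∈ S' ↔ y ∈ S') then (0 : ℂ) else (1 / 2 : ℂ)) *
          ∏ i ∈ (S'.map (Equiv.swap x y).toEmbedding)ᶜ, w i)) :
    F T + F (insert y T) + (F (insert x T) + F (insert x (insert y T))) =
      (∏ i ∈ T, z i) * (∏ i ∈ R \ T, w i) *
        ((1 + ε * Δ * (1 / 4)) * (z x * z y + w x * w y) +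
          (1 - ε * Δ * (1 / 4)) * (z x * w y + z y * w x) + ε * (1 / 2) * (z x * w x + z y * w y)) := by
  obtain ⟨hc0, hcx, hcy, hcxy⟩ := gate_compl_eq hR hxR hyR hxy hT
  have hxT : x ∉ T := fun h => hxR (hT h)
  have hyT : y ∉ T := fun h => hyR (hT h)
  obtain ⟨hsx, hsy⟩ := gate_map_swap_insert (x := x) (y := y) hxT hyT
  have hx1 : x ∉ insert y T := by simp [hxy, hxT]
  have hx2 : x ∉ insert y (R \ T) := by simp [hxy, hxR]
  have hy2 : y ∉ R \ T := by simp [hyR]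
  have hx3 : x ∉ R \ T := by simp [hxR]
  have e1 : (x ∈ T ↔ y ∈ T) := iff_of_false hxT hyT
  have e2 : ¬ (x ∈ insert x T ↔ y ∈ insert x T) := by simp [hyT, hxy.symm]
  have e3 : ¬ (x ∈ insert y T ↔ y ∈ insert y T) := by simp [hxT, hxy]
  have e4 : (x ∈ insert x (insert y T) ↔ y ∈ insert x (insert y T)) := by simp
  rw [hF T, hF (insert y T), hF (insert x T), hF (insert x (insert y T)), if_pos e1, if_pos e1,
    if_neg e2, if_neg e2, if_neg e3, if_neg e3, if_pos e4, if_pos e4, hsx, hsy, hc0, hcx, hcy, hcxy,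
    Finset.prod_insert hxT, Finset.prod_insert hyT, Finset.prod_insert hx1, Finset.prod_insert hyT,
    Finset.prod_insert hx2, Finset.prod_insert hy2, Finset.prod_insert hx3]
  ring

/-- **The Borcea–Brändén symbol of the gate factorises**:
`Σ_S (Σ_{S'} K(S', S) z^{S'}) w^{Sᶜ} = q(z_x, z_y, w_x, w_y) · ∏_{i ∈ R} (z_i + w_i)`,
`R = univ ∖ {x, y}`. [folklore] -/
theorem gate_symbol_eq {x y : Λ} {R : Finset Λ} (hR : insert x (insert y R) = univ) (hxR : x ∉ R)
    (hyR : y ∉ R) (hxy : x ≠ y) (Δ ε : ℂ) (z w : Λ → ℂ) :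
    (∑ S : Finset Λ, (∑ S' : Finset Λ,
        ((if S = S' then 1 + ε * Δ * (if (x ∈ S' ↔ y ∈ S') then (1 / 4 : ℂ) else -(1 / 4 : ℂ)) else 0) +
          (if S = S'.map (Equiv.swap x y).toEmbedding then
            ε * (if (x ∈ S' ↔ y ∈ S') then (0 : ℂ) else (1 / 2 : ℂ)) else 0)) *
        ∏ i ∈ S', z i) * ∏ i ∈ Sᶜ, w i) =
      ((1 + ε * Δ * (1 / 4)) * (z x * z y + w x * w y) +
          (1 - ε * Δ * (1 / 4)) * (z x * w y + z y * w x) + ε * (1 / 2) * (z x * w x + z y * w y)) *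
        ∏ i ∈ R, (z i + w i) := by
  rw [gate_symbol_rearrange (fun S' => 1 + ε * Δ * (if (x ∈ S' ↔ y ∈ S') then (1 / 4 : ℂ) else -(1 / 4 : ℂ)))
      (fun S' => ε * (if (x ∈ S' ↔ y ∈ S') then (0 : ℂ) else (1 / 2 : ℂ)))
      (fun S' => S'.map (Equiv.swap x y).toEmbedding) z w,
    gate_sum_pair hR hxR hyR hxy, Finset.prod_add, Finset.mul_sum]
  refine Finset.sum_congr rfl fun T hT => ?_
  rw [gate_four_terms hR hxR hyR hxy (Finset.mem_powerset.1 hT) Δ ε z w _ (fun S' => rfl)]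
  ring

end Action

/-! ### The stub -/

/-- **Stub A — the Euler bond gate is a Borcea–Brändén preserver inside the window.** For
`|Δ| ≤ 1` and a step `0 ≤ ε ≤ 1`, the first-order bond gate `1 + ε(S¹_xS¹_y + S²_xS²_y + ΔS³_xS³_y)`
(six-vertex weights `a = 1 + εΔ/4` (parallel), `b = 1 − εΔ/4` (antiparallel), `c = ε/2` (hop),
a triangle iff `|Δ| ≤ 1`) maps a coefficient vector with `H^Λ`-stable occupation polynomial to one
whose polynomial is stable or to `0`: the gate acts on the coefficients through a kernel whose
Borcea–Brändén symbol is `q(z_x,z_y,w_x,w_y) · ∏_{i≠x,y}(z_i + w_i)` with `q` the Lorentzian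
six-vertex quadratic (`gate_symbol_eq`, `gate_quad_ne_zero`), so the PROVED kernel form of
Borcea–Brändén's Lemma 2.2 (`multiAffine_kernel_stable_or_zero`) applies.
[cite: BorceaBranden2009, §2.1, Lemma 2.2] -/
theorem stub_eulerGate :
    ∀ (Λ : Type) [Fintype Λ] [DecidableEq Λ] (x y : Λ), x ≠ y → ∀ (Δ ε : ℝ), |Δ| ≤ 1 → 0 ≤ ε → ε ≤ 1 →
      ∀ φ : TensorIndex Λ 2 → ℂ,
        (∀ z : Λ → ℂ, (∀ i, 0 < (z i).im) →
          (∑ S : Finset Λ, φ (fun i => if i ∈ S then 0 else 1) * ∏ i ∈ S, z i) ≠ 0) →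
        ((1 + (ε : ℂ) • (spinBond 1 0 x y + spinBond 1 1 x y + (Δ : ℂ) • spinBond 1 2 x y)) *ᵥ φ = 0 ∨
          (∀ z : Λ → ℂ, (∀ i, 0 < (z i).im) →
          (∑ S : Finset Λ, ((1 + (ε : ℂ) • (spinBond 1 0 x y + spinBond 1 1 x y + (Δ : ℂ) • spinBond 1 2 x y)) *ᵥ φ) (fun i => if i ∈ S then 0 else 1) * ∏ i ∈ S, z i) ≠ 0)) := by
  intro Λ _ _ x y hxy Δ ε hΔ hε0 hε1 φ hφ
  -- the kernel of the gate on occupation coefficients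
  set K : Finset Λ → Finset Λ → ℂ := fun S' S =>
    (if S = S' then 1 + (ε : ℂ) * Δ * (if (x ∈ S' ↔ y ∈ S') then (1 / 4 : ℂ) else -(1 / 4 : ℂ)) else 0) +
      (if S = S'.map (Equiv.swap x y).toEmbedding then
        (ε : ℂ) * (if (x ∈ S' ↔ y ∈ S') then (0 : ℂ) else (1 / 2 : ℂ)) else 0) with hK
  have haction : ∀ S' : Finset Λ,
      ((1 + (ε : ℂ) • (spinBond 1 0 x y + spinBond 1 1 x y + (Δ : ℂ) • spinBond 1 2 x y)) *ᵥ φ)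
          (fun i => if i ∈ S' then 0 else 1) =
        ∑ S : Finset Λ, K S' S * φ (fun i => if i ∈ S then 0 else 1) :=
    fun S' => gate_action hxy (Δ : ℂ) (ε : ℂ) φ S'
  -- the sites other than `x, y`
  set R : Finset Λ := (univ.erase x).erase y with hRdef
  have hR : insert x (insert y R) = univ := by
    rw [hRdef, Finset.insert_erase (Finset.mem_erase.2 ⟨hxy.symm, Finset.mem_univ y⟩),
      Finset.insert_erase (Finset.mem_univ x)]
  have hxR : x ∉ R := by simp [hRdef]
  have hyR : y ∉ R := by simp [hRdef]
  -- the six-vertex weights form a triangle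
  have hεΔ : |ε * Δ| ≤ 1 := by
    rw [abs_mul, abs_of_nonneg hε0]
    nlinarith [abs_nonneg Δ]
  obtain ⟨hεΔ1, hεΔ2⟩ := abs_le.1 hεΔ
  obtain ⟨hΔ1, hΔ2⟩ := abs_le.1 hΔ
  -- the symbol does not vanish on `H^Λ × H^Λ`
  have hsymb : ∀ z w : Λ → ℂ, (∀ i, 0 < (z i).im) → (∀ i, 0 < (w i).im) →
      (∑ S : Finset Λ, (∑ S' : Finset Λ, K S' S * ∏ i ∈ S', z i) * ∏ i ∈ Sᶜ, w i) ≠ 0 := by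
    intro z w hz hw
    rw [show (∑ S : Finset Λ, (∑ S' : Finset Λ, K S' S * ∏ i ∈ S', z i) * ∏ i ∈ Sᶜ, w i) = _ from
      gate_symbol_eq hR hxR hyR hxy (Δ : ℂ) (ε : ℂ) z w]
    refine mul_ne_zero ?_ (Finset.prod_ne_zero_iff.2 fun i _ h => ?_)
    · have hq := gate_quad_ne_zero (a := 1 + ε * Δ / 4) (b := 1 - ε * Δ / 4) (c := ε / 2)
        (by linarith) (by linarith) (by linarith) (by nlinarith) (by nlinarith) (by linarith)
        (by linarith) (hz x) (hz y) (hw x) (hw y)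
      convert hq using 1
      push_cast
      ring
    · have := congrArg Complex.im h
      rw [Complex.add_im, Complex.zero_im] at this; linarith [hz i, hw i]
  -- Borcea–Brändén, Lemma 2.2 (kernel form)
  rcases multiAffine_kernel_stable_or_zero K hsymb
      (a := fun S => φ (fun i => if i ∈ S then 0 else 1)) hφ with h0 | hst
  · refine Or.inl (funext fun σ => ?_)
    rw [Pi.zero_apply, ← coneSel_indicator_filter_eq σ, haction]
    exact h0 _
  · refine Or.inr fun z hz => ?_
    simp only [haction]
    exact hst z hz


end Summit.AtomisticToContinuum.BoseEinsteinCondensation.Cruxes.GroundStateStability.StableConeVariationalSelection
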